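import Summits.AtomisticToContinuum.Crystallization.Theorems.ExcessDecayLiouvilleCaccioppoliTail
import Summits.AtomisticToContinuum.Crystallization.Theorems.ExcessDecayLiouvilleGradientEstimateLocal

/-!
# Route `ExcessDecayLiouville`: the localised Caccioppoli bound with a WEIGHTED `ℓ²` tail

Weighted form of `ExcessDecayLiouvilleCaccioppoliTail(Bound).lean` for the Caccioppoli LEVELS `k ≥ 2` of the linear
interior-decay estimate of item `ExcessDecay` (stmt-AtomisticToContinuum-9334), harmonic-replacement architecture.
At level `k` the local mass `M(h;R)` of the difference field is small (`~ E_{k−1}`) while its tail `TT(h)` is not, so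
the far pairs must be paired by their GEOMETRIC mean: we keep a free weight `μ > 0`,
`|h_p||h_q| ≤ (μ|h_p|² + μ⁻¹|h_q|²)/2`, and the user optimises `μ`:

* `cutoffTerm_le_tail_weighted` : termwise majorant;
* `abs_cutoffForm_le_tail_weighted` :
  `|½ΣΣ (η_p−η_q)² ⟪K h_p, h_q⟫| ≤ (19·C₆/ρ²) M(R+ρ) + 19μ·F₈(ρ)·M(R) + 19μ⁻¹·TT(h; c, R, ρ)`;
* `caccioppoli_l2_tail_weighted`, `gradient_estimate_tail_weighted_of_cutoff_of_dom` : the consequences.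

All `[folklore]`; helper lemmas, nothing here closes an item.
-/

noncomputable section

namespace Summit.AtomisticToContinuum.Crystallization.Theorems.ExcessDecayLiouville

open scoped BigOperators Topology InnerProductSpace RealInnerProductSpace Classical
open Literature.MathematicalPhysics.StatisticalMechanics
open Summit.AtomisticToContinuum.Crystallization.Theorems.PhononStabilityNegative

-- Local notation: the force-constant map `K(e)w = h(|e|²)w + 2⟪e,w⟫h′(|e|²)e`.
local notation3 "𝕂[" e "] " w:max =>
  (-((‖e‖ ^ 2)⁻¹) ^ 7 + ((‖e‖ ^ 2)⁻¹) ^ 4) • w + (2 * ⟪e, w⟫ * (7 * ((‖e‖ ^ 2)⁻¹) ^ 8 - 4 * ((‖e‖ ^ 2)⁻¹) ^ 5)) • e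
-- indicator of a closed ball and the far inverse-power weight
set_option quotPrecheck false in
local notation "𝟙ᵇ[" x ", " c ", " R "]" => (if dist (x : EuclideanSpace ℝ (Fin 3)) c ≤ R then (1 : ℝ) else 0)
set_option quotPrecheck false in
local notation "𝔣[" ρ ", " p ", " q "]" =>
  (if ρ < dist (p : EuclideanSpace ℝ (Fin 3)) q then (dist (p : EuclideanSpace ℝ (Fin 3)) q)⁻¹ ^ 8 else (0 : ℝ))

section

variable {t : Fin 2 → (EuclideanSpace ℝ (Fin 3))} {A : (EuclideanSpace ℝ (Fin 3)) →L[ℝ] (EuclideanSpace ℝ (Fin 3))}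

/-- Termwise bound for the WEIGHTED tail form: the far pairs through `|h_p||h_q| ≤ (μ|h_p|² + μ⁻¹|h_q|²)/2`
(free parameter `μ > 0`, to be optimised by the user: geometric mean of local mass and tail). [folklore] -/
theorem cutoffTerm_le_tail_weighted (hA : Adm₀ A) (hI : Inner₀ t A) {h : (EuclideanSpace ℝ (Fin 3)) → (EuclideanSpace ℝ (Fin 3))}
    {η : (EuclideanSpace ℝ (Fin 3)) → ℝ} (hη0 : ∀ x, 0 ≤ η x) (hη1 : ∀ x, η x ≤ 1)
    {c : (EuclideanSpace ℝ (Fin 3))} {R ρ μ : ℝ} (hρ : 1 ≤ ρ) (hμ : 0 < μ)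
    (hηR : ∀ p : Sites₀ t A, R < dist (p : (EuclideanSpace ℝ (Fin 3))) c → η p = 0)
    (hlip : ∀ p q : Sites₀ t A, |η p - η q| ≤ ‖(p : (EuclideanSpace ℝ (Fin 3))) - q‖ / ρ) (p q : Sites₀ t A) :
    |(if (p : (EuclideanSpace ℝ (Fin 3))) ≠ q then (η p - η q) ^ 2 *
        ⟪𝕂[(p : (EuclideanSpace ℝ (Fin 3))) - q] (h p), h q⟫ else 0)| ≤
      19 / ρ ^ 2 * ((if (p : (EuclideanSpace ℝ (Fin 3))) ≠ q then (dist (p : (EuclideanSpace ℝ (Fin 3))) q)⁻¹ ^ 6 * (‖h q‖ ^ 2 * 𝟙ᵇ[q, c, R + ρ]) else 0) +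
        (if (q : (EuclideanSpace ℝ (Fin 3))) ≠ p then (dist (q : (EuclideanSpace ℝ (Fin 3))) p)⁻¹ ^ 6 * (‖h p‖ ^ 2 * 𝟙ᵇ[p, c, R + ρ]) else 0)) +
      19 * (μ * (if (p : (EuclideanSpace ℝ (Fin 3))) ≠ q then 𝔣[ρ, p, q] * 𝟙ᵇ[p, c, R] * ‖h p‖ ^ 2 else 0) +
        μ * (if (q : (EuclideanSpace ℝ (Fin 3))) ≠ p then 𝔣[ρ, q, p] * 𝟙ᵇ[q, c, R] * ‖h q‖ ^ 2 else 0) +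
        μ⁻¹ * (if (p : (EuclideanSpace ℝ (Fin 3))) ≠ q then 𝔣[ρ, p, q] * 𝟙ᵇ[p, c, R] * ‖h q‖ ^ 2 else 0) +
        μ⁻¹ * (if (q : (EuclideanSpace ℝ (Fin 3))) ≠ p then 𝔣[ρ, q, p] * 𝟙ᵇ[q, c, R] * ‖h p‖ ^ 2 else 0)) := by
  have hρ0 : 0 < ρ := by linarith
  by_cases hpq : (p : (EuclideanSpace ℝ (Fin 3))) = q
  · simp [hpq]
  · have hqp : (q : (EuclideanSpace ℝ (Fin 3))) ≠ p := fun h' => hpq h'.symm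
    rw [if_pos hpq, if_pos hpq, if_pos hqp, if_pos hpq, if_pos hqp, if_pos hpq, if_pos hqp, abs_mul, abs_pow, sq_abs]
    have hd : (23 / 25 : ℝ) ≤ dist (p : (EuclideanSpace ℝ (Fin 3))) q := dist_sites_ge hA hI p.2 q.2 hpq
    have he : 9 / 10 ≤ ‖(p : (EuclideanSpace ℝ (Fin 3))) - q‖ := by rw [← dist_eq_norm]; linarith
    have hdpos : 0 < dist (p : (EuclideanSpace ℝ (Fin 3))) q := by linarith
    set d := dist (p : (EuclideanSpace ℝ (Fin 3))) q with hdd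
    have hnd : ‖(p : (EuclideanSpace ℝ (Fin 3))) - q‖ = d := by rw [hdd, dist_eq_norm]
    have hdqp : dist (q : (EuclideanSpace ℝ (Fin 3))) p = d := by rw [hdd, dist_comm]
    rw [hdqp]
    have hin : |⟪𝕂[(p : (EuclideanSpace ℝ (Fin 3))) - q] (h p), h q⟫| ≤ 38 * (d⁻¹) ^ 8 * ‖h p‖ * ‖h q‖ := by
      have := (abs_real_inner_le_norm _ _).trans
        (mul_le_mul_of_nonneg_right (norm_forceConst_apply_le he (h p)) (norm_nonneg (h q)))
      rw [hnd] at this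
      exact this
    have hIp0 : (0 : ℝ) ≤ 𝟙ᵇ[p, c, R] := by split_ifs <;> norm_num
    have hIq0 : (0 : ℝ) ≤ 𝟙ᵇ[q, c, R] := by split_ifs <;> norm_num
    have hIp0' : (0 : ℝ) ≤ 𝟙ᵇ[p, c, R + ρ] := by split_ifs <;> norm_num
    have hIq0' : (0 : ℝ) ≤ 𝟙ᵇ[q, c, R + ρ] := by split_ifs <;> norm_num
    have hnear0 : 0 ≤ 19 / ρ ^ 2 * ((d⁻¹) ^ 6 * (‖h q‖ ^ 2 * 𝟙ᵇ[q, c, R + ρ]) + (d⁻¹) ^ 6 * (‖h p‖ ^ 2 * 𝟙ᵇ[p, c, R + ρ])) := by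
      positivity
    by_cases hfar : ρ < d
    · -- far pairs: AM–GM instead of the global sup
      rw [if_pos hfar]
      have hind : (η p - η q) ^ 2 ≤ 𝟙ᵇ[p, c, R] + 𝟙ᵇ[q, c, R] := by
        by_cases hp' : dist (p : (EuclideanSpace ℝ (Fin 3))) c ≤ R
        · rw [if_pos hp']
          have h0p := hη0 p; have h1p := hη1 p; have h0q := hη0 q; have h1q := hη1 q
          nlinarith
        · by_cases hq' : dist (q : (EuclideanSpace ℝ (Fin 3))) c ≤ R
          · rw [if_neg hp', if_pos hq']
            have h0p := hη0 p; have h1p := hη1 p; have h0q := hη0 q; have h1q := hη1 q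
            nlinarith
          · rw [if_neg hp', if_neg hq', hηR p (lt_of_not_ge hp'), hηR q (lt_of_not_ge hq')]; norm_num
      have hμ0 : 0 ≤ μ := hμ.le
      have hμi0 : 0 ≤ μ⁻¹ := by positivity
      have hamgm1 : ‖h p‖ * ‖h q‖ ≤ (μ * ‖h p‖ ^ 2 + μ⁻¹ * ‖h q‖ ^ 2) / 2 := by
        have hsq : 0 ≤ (μ * ‖h p‖ - ‖h q‖) ^ 2 := sq_nonneg _
        have hμμ : μ * μ⁻¹ = 1 := mul_inv_cancel₀ hμ.ne'
        nlinarith [hsq, hμμ, norm_nonneg (h p), norm_nonneg (h q)]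
      have hamgm2 : ‖h p‖ * ‖h q‖ ≤ (μ * ‖h q‖ ^ 2 + μ⁻¹ * ‖h p‖ ^ 2) / 2 := by
        have hsq : 0 ≤ (μ * ‖h q‖ - ‖h p‖) ^ 2 := sq_nonneg _
        have hμμ : μ * μ⁻¹ = 1 := mul_inv_cancel₀ hμ.ne'
        nlinarith [hsq, hμμ, norm_nonneg (h p), norm_nonneg (h q)]
      have h8pos : 0 ≤ (d⁻¹) ^ 8 := by positivity
      have hP : 0 ≤ 38 * (d⁻¹) ^ 8 := by positivity
      calc (η p - η q) ^ 2 * |⟪𝕂[(p : (EuclideanSpace ℝ (Fin 3))) - q] (h p), h q⟫|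
          ≤ (𝟙ᵇ[p, c, R] + 𝟙ᵇ[q, c, R]) * (38 * (d⁻¹) ^ 8 * ‖h p‖ * ‖h q‖) :=
            mul_le_mul hind hin (abs_nonneg _) (by positivity)
        _ = 𝟙ᵇ[p, c, R] * (38 * (d⁻¹) ^ 8) * (‖h p‖ * ‖h q‖) + 𝟙ᵇ[q, c, R] * (38 * (d⁻¹) ^ 8) * (‖h p‖ * ‖h q‖) := by ring
        _ ≤ 𝟙ᵇ[p, c, R] * (38 * (d⁻¹) ^ 8) * ((μ * ‖h p‖ ^ 2 + μ⁻¹ * ‖h q‖ ^ 2) / 2) +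
            𝟙ᵇ[q, c, R] * (38 * (d⁻¹) ^ 8) * ((μ * ‖h q‖ ^ 2 + μ⁻¹ * ‖h p‖ ^ 2) / 2) := by gcongr
        _ = 19 * (μ * ((d⁻¹) ^ 8 * 𝟙ᵇ[p, c, R] * ‖h p‖ ^ 2) + μ * ((d⁻¹) ^ 8 * 𝟙ᵇ[q, c, R] * ‖h q‖ ^ 2) +
              μ⁻¹ * ((d⁻¹) ^ 8 * 𝟙ᵇ[p, c, R] * ‖h q‖ ^ 2) + μ⁻¹ * ((d⁻¹) ^ 8 * 𝟙ᵇ[q, c, R] * ‖h p‖ ^ 2)) := by ring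
        _ ≤ _ := by linarith
    · -- near pairs: exactly as in `cutoffTerm_le_local`
      rw [if_neg hfar]
      have hdle : d ≤ ρ := le_of_not_gt hfar
      have hfar0 : (0 : ℝ) ≤ 19 * (μ * (0 * 𝟙ᵇ[p, c, R] * ‖h p‖ ^ 2) + μ * (0 * 𝟙ᵇ[q, c, R] * ‖h q‖ ^ 2) +
          μ⁻¹ * (0 * 𝟙ᵇ[p, c, R] * ‖h q‖ ^ 2) + μ⁻¹ * (0 * 𝟙ᵇ[q, c, R] * ‖h p‖ ^ 2)) := by
        simp
      by_cases hηeq : η p = η q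
      · rw [hηeq, sub_self]
        have : (0 : ℝ) ^ 2 * |⟪𝕂[(p : (EuclideanSpace ℝ (Fin 3))) - q] (h p), h q⟫| = 0 := by ring
        rw [this]
        linarith
      · have hone : η p ≠ 0 ∨ η q ≠ 0 := by
          by_contra hcon
          push Not at hcon
          exact hηeq (by rw [hcon.1, hcon.2])
        have hnear : dist (p : (EuclideanSpace ℝ (Fin 3))) c ≤ R + ρ ∧ dist (q : (EuclideanSpace ℝ (Fin 3))) c ≤ R + ρ := by
          rcases hone with h1 | h1
          · have hpR : dist (p : (EuclideanSpace ℝ (Fin 3))) c ≤ R := le_of_not_gt fun h' => h1 (hηR p h')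
            refine ⟨by linarith, ?_⟩
            have := dist_triangle (q : (EuclideanSpace ℝ (Fin 3))) p c
            rw [hdqp] at this
            linarith
          · have hqR : dist (q : (EuclideanSpace ℝ (Fin 3))) c ≤ R := le_of_not_gt fun h' => h1 (hηR q h')
            refine ⟨?_, by linarith⟩
            have := dist_triangle (p : (EuclideanSpace ℝ (Fin 3))) q c
            rw [← hdd] at this
            linarith
        rw [if_pos hnear.1, if_pos hnear.2, mul_one, mul_one]
        have hηsq : (η p - η q) ^ 2 ≤ d ^ 2 / ρ ^ 2 := by
          have h1 := hlip p q
          rw [hnd] at h1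
          calc (η p - η q) ^ 2 = |η p - η q| ^ 2 := (sq_abs _).symm
            _ ≤ (d / ρ) ^ 2 := pow_le_pow_left₀ (abs_nonneg _) h1 2
            _ = d ^ 2 / ρ ^ 2 := by rw [div_pow]
        have hd6 : (d⁻¹) ^ 8 * d ^ 2 = (d⁻¹) ^ 6 := by field_simp
        have hprod : (η p - η q) ^ 2 * |⟪𝕂[(p : (EuclideanSpace ℝ (Fin 3))) - q] (h p), h q⟫| ≤
            (d ^ 2 / ρ ^ 2) * (38 * (d⁻¹) ^ 8 * ‖h p‖ * ‖h q‖) :=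
          mul_le_mul hηsq hin (abs_nonneg _) (by positivity)
        have hamgm : ‖h p‖ * ‖h q‖ ≤ (‖h p‖ ^ 2 + ‖h q‖ ^ 2) / 2 := by nlinarith [sq_nonneg (‖h p‖ - ‖h q‖)]
        have h6pos : 0 ≤ (d⁻¹) ^ 6 := by positivity
        calc (η p - η q) ^ 2 * |⟪𝕂[(p : (EuclideanSpace ℝ (Fin 3))) - q] (h p), h q⟫|
            ≤ (d ^ 2 / ρ ^ 2) * (38 * (d⁻¹) ^ 8 * ‖h p‖ * ‖h q‖) := hprod
          _ = 38 / ρ ^ 2 * ((d⁻¹) ^ 8 * d ^ 2) * (‖h p‖ * ‖h q‖) := by ring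
          _ = 38 / ρ ^ 2 * (d⁻¹) ^ 6 * (‖h p‖ * ‖h q‖) := by rw [hd6]
          _ ≤ 38 / ρ ^ 2 * (d⁻¹) ^ 6 * ((‖h p‖ ^ 2 + ‖h q‖ ^ 2) / 2) := by gcongr
          _ = 19 / ρ ^ 2 * ((d⁻¹) ^ 6 * ‖h q‖ ^ 2 + (d⁻¹) ^ 6 * ‖h p‖ ^ 2) := by ring
          _ ≤ _ := by linarith

end

end Summit.AtomisticToContinuum.Crystallization.Theorems.ExcessDecayLiouville

end
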